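import Mathlib
import Summits.KontsevichZagierPeriods.Zeta5Search.BrickLaurent

/-!
# BrickLaurentValuation — the product form (C1⁺) of the Laurent series of the brick kernel at a pole and the
MASTER VALUATION BOUND `v_p(c_{K,A−d}(n)) ≥ v_p(c_{K,A}(n)) − w·d − e` (cell zeta5-irr)

HONEST FRAMING: systematic search; no irrationality claim unless certified. INSTRUMENT lemma of the ζ(5)
census cell zeta5-irr (HOME `run/shared/lean/pub/zeta5-irr/`; memo `zi-p2/probes/B8/thm6/THEOREM6.md` Step C⁺
«COMPENSATED VALUATION LEMMA», `zi-p2/probes/B8/thm7-plan/PLAN-T7.md` L7.1/L7.8, and the ONE-DIGIT INTEGRALITY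
LEMMA of Step E⁺; design note HOME `zi-eng/lean-g8/DESIGN-CELLS.md`). Nothing here is about ζ(5); no
irrationality content; filing moves no rung. Filed by the engine seat zi-eng (g8); sequel of `BrickLaurent`.

## The statement

`F_K(T) = T^A·R_n(−K+T)` (`BrickLaurent.laurentSeries A B ε n K`) is, coefficientwise, the product
`F_K(T) = c·∏_x(1 + T/x)^{μ_x}` over the OFFSETS `x` of the other linear factors of `R_n` seen from `−K`:
numerator roots `x = −(K+m)`, `x = n+m−K` (`1 ≤ m ≤ n`, multiplicity `B`), the centre `x = n/2 − K` (multiplicity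
`ε`, assumed `≠ 0` here) and the other poles `x = m − K` (`m ≤ n`, `m ≠ K`, multiplicity `−A`), with `c = F_K(0)`
(`laurentSeries_eq_C_mul`: `F_K = C(laurent … 0)·U`, `U(0) = 1`). Valuations of Taylor coefficients are controlled
by the predicate **`IsScaledInt p w e f :⇔ v_p([T^k]f) ≥ −(w·k + e) ∀ k`** (multiplicative in `(f, e)`:
`isScaledInt_mul/prod/pow`); a factor `1 + T/x` is `(w, (v_p(x) − w)⁺)`-integral, an inverse factor `(1 + T/x)^{−1} =
Σ(−T/x)^k` is `(w, 0)`-integral as soon as `v_p(x) ≤ w`. HENCE (`laurentSeries_eq_C_mul`, `padicValuation_laurent_le`):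
if every `1 ≤ d ≤ n` has `v_p(d) ≤ w` (all pole offsets) and
`e ≥ ε·(v_p(n−2K) − w)⁺ + B·Σ_{m=1}^{n}[(v_p(K+m) − w)⁺ + (v_p(n+m−K) − w)⁺]`, then for every depth `d`

**`v_p(laurent A B ε n K d) ≥ v_p(cTop A B ε n K) − w·d − e`**, i.e. `v_p(c_{K,s}(n)) ≥ v_p(c_{K,A}(n)) − w(A−s) − e`
(`padicValuation_cell_le`). Instances: THEOREM 5 Step C (`n < p²/2`: `w = 1`, `e = 0`); THEOREM 6 C⁺ (`n < p²`:
`w = 1`, `e = B·σ_K`, `σ_K = [n+K ≥ p²] + [2n−K ≥ p²]`); PLAN-T7 L7.1 (`w = 2`, `e = Bσ^{(2)}_K`); G⁺/L7.8 (off-digit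
poles of `R_{np}`); ONE-DIGIT INTEGRALITY (`m < p`: `w = 0`, `e = B([k+m ≥ p] + [2m−k ≥ p])`). The CENTRE
(`2K = n`, `ε = 1`) is reduced to `ε = 0` by the exact shift `laurentSeries_succ` (`F^{ε+1}_K = (T + n/2 − K)·F^{ε}_K`):
`laurent A B 1 n K (d+1) = laurent A B 0 n K d` (`laurent_centre_succ`), `laurent A B 1 n K 0 = 0`.
-/

namespace Summit.KontsevichZagierPeriods.Zeta5Search.BrickLaurentValuation

open Finset Nat Polynomial WithZero
open Summit.KontsevichZagierPeriods.Zeta5Search.BrickTopCoefficient (cTop)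
open Summit.KontsevichZagierPeriods.Zeta5Search.BrickLaurent (expandAt laurentSeries laurent cell kerNum
  kerDenErase constantCoeff_coe_taylor laurent_zero expandAt_mul eval_kerDenErase_neg_ne_zero)

noncomputable section

variable {p : ℕ} [Fact p.Prime]

/-! ## `(w,e)`-scaled integrality of power series -/

/-- `IsScaledInt p w e f`: `v_p([T^k]f) ≥ −(w·k + e)` for every `k` (equivalently `p^e·f(p^wT) ∈ ℤ_(p)⟦T⟧`). -/
def IsScaledInt (p : ℕ) [Fact p.Prime] (w e : ℕ) (f : PowerSeries ℚ) : Prop :=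
  ∀ k, Rat.padicValuation p (PowerSeries.coeff k f) ≤ exp (((w * k + e : ℕ) : ℤ))

/-- Monotonicity in the budget `e`. -/
theorem isScaledInt_mono {w e e' : ℕ} (h : e ≤ e') {f : PowerSeries ℚ} (hf : IsScaledInt p w e f) :
    IsScaledInt p w e' f :=
  fun k => (hf k).trans (exp_le_exp.2 (Nat.cast_le.2 (Nat.add_le_add_left h _)))

/-- `1` is `(w,0)`-integral. -/
theorem isScaledInt_one (w : ℕ) : IsScaledInt p w 0 (1 : PowerSeries ℚ) := by
  intro k
  rw [PowerSeries.coeff_one]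
  split_ifs
  · rw [map_one, ← exp_zero, exp_le_exp]; exact Int.natCast_nonneg _
  · rw [map_zero]; exact _root_.zero_le

/-- **Multiplicativity**: budgets add under products (the valuation of a sum is at most the maximum). -/
theorem isScaledInt_mul {w e₁ e₂ : ℕ} {f g : PowerSeries ℚ} (hf : IsScaledInt p w e₁ f) (hg : IsScaledInt p w e₂ g) :
    IsScaledInt p w (e₁ + e₂) (f * g) := by
  intro k
  rw [PowerSeries.coeff_mul]
  refine Valuation.map_sum_le _ fun x hx => ?_
  rw [map_mul]
  have hk := mem_antidiagonal.1 hx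
  calc Rat.padicValuation p (PowerSeries.coeff x.1 f) * Rat.padicValuation p (PowerSeries.coeff x.2 g)
      ≤ exp (((w * x.1 + e₁ : ℕ) : ℤ)) * exp (((w * x.2 + e₂ : ℕ) : ℤ)) := mul_le_mul' (hf x.1) (hg x.2)
    _ = exp (((w * k + (e₁ + e₂) : ℕ) : ℤ)) := by rw [← exp_add, ← hk]; congr 1; push_cast; ring

/-- Products over a finset. -/
theorem isScaledInt_prod {ι : Type*} {w : ℕ} {e : ι → ℕ} {f : ι → PowerSeries ℚ} (s : Finset ι)
    (h : ∀ i ∈ s, IsScaledInt p w (e i) (f i)) : IsScaledInt p w (∑ i ∈ s, e i) (∏ i ∈ s, f i) := by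
  classical
  induction s using Finset.induction_on with
  | empty => simpa using isScaledInt_one (p := p) w
  | insert a s ha ih =>
    rw [Finset.prod_insert ha, Finset.sum_insert ha]
    exact isScaledInt_mul (h a (mem_insert_self a s)) (ih fun i hi => h i (mem_insert_of_mem hi))

/-- Powers. -/
theorem isScaledInt_pow {w e : ℕ} {f : PowerSeries ℚ} (hf : IsScaledInt p w e f) (m : ℕ) :
    IsScaledInt p w (m * e) (f ^ m) := by
  induction m with
  | zero => simpa using isScaledInt_one (p := p) w
  | succ m ih => rw [pow_succ, Nat.succ_mul]; exact isScaledInt_mul ih hf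

/-! ## Linear factors and their inverses -/

/-- The normalised linear factor `1 + T/x`. -/
def lin (x : ℚ) : PowerSeries ℚ := 1 + PowerSeries.C x⁻¹ * PowerSeries.X

/-- The geometric series `Σ_k(−y)^kT^k = (1 + yT)^{−1}`. -/
def geom (y : ℚ) : PowerSeries ℚ := PowerSeries.mk fun k => (-y) ^ k

/-- `(1 + T/x)(0) = 1`. -/
@[simp] theorem constantCoeff_lin (x : ℚ) : PowerSeries.constantCoeff (lin x) = 1 := by simp [lin]

/-- `geom y (0) = 1`. -/
@[simp] theorem constantCoeff_geom (y : ℚ) : PowerSeries.constantCoeff (geom y) = 1 := by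
  rw [← PowerSeries.coeff_zero_eq_constantCoeff_apply, geom, PowerSeries.coeff_mk, pow_zero]

/-- `X + x = x·(1 + T/x)` as power series (`x ≠ 0`). -/
theorem coe_X_add_C {x : ℚ} (hx : x ≠ 0) :
    ((X + C x : ℚ[X]) : PowerSeries ℚ) = PowerSeries.C x * lin x := by
  rw [lin, Polynomial.coe_add, Polynomial.coe_X, Polynomial.coe_C, mul_add, mul_one, ← mul_assoc, ← map_mul,
    mul_inv_cancel₀ hx, map_one, one_mul, add_comm]

/-- `∏_i(X + x_i) = C(∏_i x_i)·∏_i(1 + T/x_i)` as power series (all `x_i ≠ 0`). -/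
theorem coe_prod_X_add_C {ι : Type*} (s : Finset ι) {x : ι → ℚ} (hx : ∀ i ∈ s, x i ≠ 0) :
    ((∏ i ∈ s, (X + C (x i)) : ℚ[X]) : PowerSeries ℚ) = PowerSeries.C (∏ i ∈ s, x i) * ∏ i ∈ s, lin (x i) := by
  rw [show ((∏ i ∈ s, (X + C (x i)) : ℚ[X]) : PowerSeries ℚ) = ∏ i ∈ s, ((X + C (x i) : ℚ[X]) : PowerSeries ℚ)
    from map_prod Polynomial.coeToPowerSeries.ringHom _ s, map_prod, ← Finset.prod_mul_distrib]
  exact Finset.prod_congr rfl fun i hi => coe_X_add_C (hx i hi)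

/-- `(1 + yT)·Σ_k(−y)^kT^k = 1`. -/
theorem one_add_mul_geom (y : ℚ) : (1 + PowerSeries.C y * PowerSeries.X) * geom y = 1 := by
  ext k
  rw [add_mul, one_mul, map_add, PowerSeries.coeff_one, mul_assoc, PowerSeries.coeff_C_mul]
  rcases k with _ | k
  · rw [PowerSeries.coeff_zero_X_mul, mul_zero, add_zero, geom, PowerSeries.coeff_mk, pow_zero, if_pos rfl]
  · rw [PowerSeries.coeff_succ_X_mul, geom, PowerSeries.coeff_mk, PowerSeries.coeff_mk, if_neg (Nat.succ_ne_zero k),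
      pow_succ]
    ring

/-- `(1 + T/x)^{−1} = geom x⁻¹` in `ℚ⟦T⟧`. -/
theorem lin_inv (x : ℚ) : (lin x)⁻¹ = geom x⁻¹ := by
  rw [lin, PowerSeries.inv_eq_iff_mul_eq_one (by simp), mul_comm, one_add_mul_geom]

/-- `(∏_i (1 + T/x_i)^μ)^{−1} = ∏_i (geom x_i⁻¹)^μ`. -/
theorem prod_lin_pow_inv {ι : Type*} (s : Finset ι) (x : ι → ℚ) (μ : ℕ) :
    (∏ i ∈ s, lin (x i) ^ μ)⁻¹ = ∏ i ∈ s, geom (x i)⁻¹ ^ μ := by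
  have h1 : PowerSeries.constantCoeff (∏ i ∈ s, lin (x i) ^ μ) ≠ 0 := by
    rw [map_prod, Finset.prod_eq_one fun i _ => by rw [map_pow, constantCoeff_lin, one_pow]]
    exact one_ne_zero
  rw [PowerSeries.inv_eq_iff_mul_eq_one h1, ← Finset.prod_mul_distrib]
  refine Finset.prod_eq_one fun i _ => ?_
  rw [← mul_pow, mul_comm, lin, one_add_mul_geom, one_pow]

/-- `1 + T/x` is `(w, c)`-integral when `v_p(1/x) ≥ −(w + c)`. -/
theorem isScaledInt_lin {w c : ℕ} {x : ℚ} (hx : Rat.padicValuation p x⁻¹ ≤ exp (((w + c : ℕ) : ℤ))) :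
    IsScaledInt p w c (lin x) := by
  intro k
  rw [lin, map_add, PowerSeries.coeff_one, ← pow_one PowerSeries.X, PowerSeries.coeff_C_mul_X_pow]
  rcases k with _ | _ | k
  · rw [if_pos rfl, if_neg (by omega), add_zero, map_one, ← exp_zero, exp_le_exp]; exact Int.natCast_nonneg _
  · rw [if_neg (by omega), if_pos rfl, zero_add]
    exact hx.trans (exp_le_exp.2 (Nat.cast_le.2 (by omega)))
  · rw [if_neg (by omega), if_neg (by omega), add_zero, map_zero]; exact _root_.zero_le

/-- `geom y` is `(w, 0)`-integral when `v_p(y) ≥ −w`. -/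
theorem isScaledInt_geom {w : ℕ} {y : ℚ} (hy : Rat.padicValuation p y ≤ exp ((w : ℕ) : ℤ)) :
    IsScaledInt p w 0 (geom y) := by
  intro k
  rw [geom, PowerSeries.coeff_mk, map_pow, Valuation.map_neg, add_zero, Nat.cast_mul, mul_comm, ← nsmul_eq_mul,
    exp_nsmul]
  exact pow_le_pow_left' hy k

/-! ## Valuations of the offsets -/

/-- `v(d) = exp(−v_p(d))` for a positive natural `d`. -/
theorem padicValuation_natCast {d : ℕ} (hd : d ≠ 0) :
    Rat.padicValuation p (d : ℚ) = exp (-((padicValNat p d : ℕ) : ℤ)) := by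
  have hd' : (d : ℚ) ≠ 0 := by exact_mod_cast hd
  change (if (d : ℚ) = 0 then (0 : ℤᵐ⁰) else exp (-padicValRat p d)) = _
  rw [if_neg hd', padicValRat.of_nat]

/-- `v(1/d) = exp(v_p(d))` for a positive natural `d`. -/
theorem padicValuation_inv_natCast {d : ℕ} (hd : d ≠ 0) :
    Rat.padicValuation p ((d : ℚ))⁻¹ = exp ((padicValNat p d : ℕ) : ℤ) := by
  rw [map_inv₀, padicValuation_natCast hd, exp_neg, inv_inv]

/-- `v(1/z) = exp(v_p(|z|))` for a nonzero integer `z`. -/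
theorem padicValuation_inv_intCast {z : ℤ} (hz : z ≠ 0) :
    Rat.padicValuation p ((z : ℚ))⁻¹ = exp ((padicValNat p z.natAbs : ℕ) : ℤ) := by
  rcases Int.natAbs_eq z with h | h
  · rw [h, Int.cast_natCast, padicValuation_inv_natCast (by omega), Int.natAbs_natCast]
  · rw [h, Int.cast_neg, Int.cast_natCast, inv_neg, Valuation.map_neg, padicValuation_inv_natCast (by omega),
      Int.natAbs_neg, Int.natAbs_natCast]

/-- The budget of an offset `d`: `v(1/d) ≤ exp(w + (v_p(d) − w)⁺)`. -/
theorem padicValuation_inv_natCast_le {d : ℕ} (hd : d ≠ 0) (w : ℕ) :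
    Rat.padicValuation p ((d : ℚ))⁻¹ ≤ exp (((w + (padicValNat p d - w) : ℕ) : ℤ)) := by
  rw [padicValuation_inv_natCast hd, exp_le_exp]; exact Nat.cast_le.2 (by omega)

/-! ## The exact shift in `ε` and the centre -/

/-- `kerNum A B (ε+1) n = (X + n/2)·kerNum A B ε n`. -/
theorem kerNum_succ (A B ε n : ℕ) : kerNum A B (ε + 1) n = (X + C ((n : ℚ) / 2)) * kerNum A B ε n := by
  unfold kerNum; ring

/-- **`F^{(ε+1)}_K(T) = (T + n/2 − K)·F^{(ε)}_K(T)`** (exact). -/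
theorem laurentSeries_succ (A B ε n K : ℕ) :
    laurentSeries A B (ε + 1) n K = (PowerSeries.X + PowerSeries.C ((n : ℚ) / 2 - K)) * laurentSeries A B ε n K := by
  rw [laurentSeries, kerNum_succ, ← one_mul (kerDenErase A n K), expandAt_mul, laurentSeries]
  congr 1
  have h1 : ((1 : ℚ[X]) : PowerSeries ℚ)⁻¹ = 1 := by
    rw [Polynomial.coe_one]; exact (PowerSeries.inv_eq_iff_mul_eq_one (by simp)).2 (mul_one 1)
  rw [expandAt, taylor_one, C_1, h1, mul_one, map_add, taylor_X, taylor_C, Polynomial.coe_add, Polynomial.coe_add,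
    Polynomial.coe_X, Polynomial.coe_C, Polynomial.coe_C, add_assoc, ← map_add]
  congr 2; ring

/-- `laurent A B (ε+1) n K (d+1) = laurent A B ε n K d + (n/2 − K)·laurent A B ε n K (d+1)`. -/
theorem laurent_succ_succ (A B ε n K d : ℕ) :
    laurent A B (ε + 1) n K (d + 1) = laurent A B ε n K d + ((n : ℚ) / 2 - K) * laurent A B ε n K (d + 1) := by
  rw [laurent, laurentSeries_succ, add_mul, map_add, PowerSeries.coeff_succ_X_mul, PowerSeries.coeff_C_mul]; rfl

/-- `laurent A B (ε+1) n K 0 = (n/2 − K)·laurent A B ε n K 0`. -/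
theorem laurent_succ_zero (A B ε n K : ℕ) :
    laurent A B (ε + 1) n K 0 = ((n : ℚ) / 2 - K) * laurent A B ε n K 0 := by
  rw [laurent, laurentSeries_succ, add_mul, map_add, PowerSeries.coeff_zero_X_mul, PowerSeries.coeff_C_mul,
    zero_add]; rfl

/-- **The centre** (`2K = n`, `ε = 1`): `laurent A B 1 n K (d+1) = laurent A B 0 n K d` and `laurent A B 1 n K 0 = 0`
(the pole has order `A − 1`; zi-p2's `c′_K` is `cTop A B 0 n K`). -/
theorem laurent_centre (A B : ℕ) {n K : ℕ} (h : 2 * K = n) (d : ℕ) :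
    laurent A B 1 n K (d + 1) = laurent A B 0 n K d ∧ laurent A B 1 n K 0 = 0 := by
  have h0 : (n : ℚ) / 2 - K = 0 := by rw [← h]; push_cast; ring
  rw [laurent_succ_succ, laurent_succ_zero, h0, zero_mul, add_zero, zero_mul]
  exact ⟨rfl, rfl⟩

/-! ## The product form and the master bound -/

/-- `taylor` through a finite product. [folklore] -/
theorem taylor_prod {ι : Type*} (s : Finset ι) (f : ι → ℚ[X]) (r : ℚ) :
    taylor r (∏ i ∈ s, f i) = ∏ i ∈ s, taylor r (f i) :=
  map_prod (taylorAlgHom r) f s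

/-- `taylor_{−K}(kerNum) = C(n!^{A−2B})·(X + (n/2−K))^ε·(∏_m(X − (K+m)))^B·(∏_m(X + (n+m−K)))^B`. -/
theorem taylor_kerNum (A B ε n K : ℕ) : taylor (-(K : ℚ)) (kerNum A B ε n) =
    C ((n ! : ℚ) ^ (A - 2 * B)) * (X + C ((n : ℚ) / 2 - K)) ^ ε * (∏ m ∈ Icc 1 n, (X + C (-((K : ℚ) + m)))) ^ B *
      (∏ m ∈ Icc 1 n, (X + C ((n : ℚ) + m - K))) ^ B := by
  have e1 : (X + C (-(K : ℚ)) + C ((n : ℚ) / 2) : ℚ[X]) = X + C ((n : ℚ) / 2 - K) := by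
    rw [C_sub, C_neg]; ring
  have e2 : ∀ m : ℕ, (X + C (-(K : ℚ)) - C (m : ℚ) : ℚ[X]) = X + C (-((K : ℚ) + m)) := fun m => by
    rw [C_neg, C_neg, C_add]; ring
  have e3 : ∀ m : ℕ, (X + C (-(K : ℚ)) + C (n : ℚ) + C (m : ℚ) : ℚ[X]) = X + C ((n : ℚ) + m - K) := fun m => by
    rw [C_sub, C_add, C_neg]; ring
  conv_lhs =>
    rw [kerNum]; simp only [taylor_mul, taylor_pow, taylor_prod, map_add, map_sub, taylor_X, taylor_C]
    simp only [e1, e2, e3]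

/-- `taylor_{−K}(kerDenErase_K) = (∏_{m≤n, m≠K}(X + (m−K)))^A`. -/
theorem taylor_kerDenErase (A n K : ℕ) :
    taylor (-(K : ℚ)) (kerDenErase A n K) = (∏ m ∈ (range (n + 1)).erase K, (X + C ((m : ℚ) - K))) ^ A := by
  have e1 : ∀ m : ℕ, (X + C (-(K : ℚ)) + C (m : ℚ) : ℚ[X]) = X + C ((m : ℚ) - K) := fun m => by
    rw [C_sub, C_neg]; ring
  conv_lhs => rw [kerDenErase]; simp only [taylor_pow, taylor_prod, map_add, taylor_X, taylor_C]; simp only [e1]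

/-- **PRODUCT FORM (C1⁺) with valuation budget.** For `K ≤ n`, `2K ≠ n` or `ε = 0`, a slope `w` with `v_p(d) ≤ w`
for all `1 ≤ d ≤ n`, and a budget `e ≥ ε(v_p(n−2K) − w)⁺ + BΣ_{m=1}^{n}[(v_p(K+m) − w)⁺ + (v_p(n+m−K) − w)⁺]`:
`F_K = C(F_K(0))·U` with `U(0) = 1` and `U` `(w,e)`-integral. -/
theorem laurentSeries_eq_C_mul (A B : ℕ) {ε n K : ℕ} (hK : K ≤ n) (hc : 2 * K ≠ n ∨ ε = 0) {w e : ℕ}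
    (hden : ∀ d, 0 < d → d ≤ n → padicValNat p d ≤ w)
    (he : ε * (padicValNat p ((n : ℤ) - 2 * K).natAbs - w) +
        B * ∑ m ∈ Icc 1 n, ((padicValNat p (K + m) - w) + (padicValNat p (n + m - K) - w)) ≤ e) :
    ∃ U : PowerSeries ℚ, PowerSeries.constantCoeff U = 1 ∧ IsScaledInt p w e U ∧
      laurentSeries A B ε n K = PowerSeries.C (laurent A B ε n K 0) * U := by
  -- the offsets and their non-vanishing
  set xc : ℚ := (n : ℚ) / 2 - K with hxc
  have hxc' : xc = ((((n : ℤ) - 2 * K : ℤ)) : ℚ) / 2 := by rw [hxc]; push_cast; ring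
  have h1 : ∀ m ∈ Icc 1 n, (-((K : ℚ) + m)) ≠ 0 := fun m hm => by
    have := (mem_Icc.1 hm).1
    rw [neg_ne_zero, ← Nat.cast_add, Nat.cast_ne_zero]; omega
  have h2 : ∀ m ∈ Icc 1 n, ((n : ℚ) + m - K) ≠ 0 := fun m hm => by
    have := (mem_Icc.1 hm).1
    rw [← Nat.cast_add, ← Nat.cast_sub (by omega), Nat.cast_ne_zero]; omega
  have h3 : ∀ m ∈ (range (n + 1)).erase K, ((m : ℚ) - K) ≠ 0 := fun m hm h =>
    Finset.ne_of_mem_erase hm (by exact_mod_cast (sub_eq_zero.1 h))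
  -- the unit series of the numerator and of the inverted denominator
  set UN : PowerSeries ℚ := lin xc ^ ε * ((∏ m ∈ Icc 1 n, lin (-((K : ℚ) + m))) ^ B *
    (∏ m ∈ Icc 1 n, lin ((n : ℚ) + m - K)) ^ B) with hUN
  set G : PowerSeries ℚ := ∏ m ∈ (range (n + 1)).erase K, geom ((m : ℚ) - K)⁻¹ ^ A with hG
  -- centre factor: a genuine nonzero offset, or absent
  have hcentre : ∃ c0 : ℚ, ((X + C xc : ℚ[X]) : PowerSeries ℚ) ^ ε = PowerSeries.C c0 * lin xc ^ ε := by
    rcases hc with hc | hc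
    · have hz : ((n : ℤ) - 2 * K) ≠ 0 := fun h => hc (by omega)
      have hx0 : xc ≠ 0 := by rw [hxc']; exact div_ne_zero (Int.cast_ne_zero.2 hz) two_ne_zero
      exact ⟨xc ^ ε, by rw [coe_X_add_C hx0, mul_pow, map_pow]⟩
    · exact ⟨1, by rw [hc, pow_zero, pow_zero, map_one, mul_one]⟩
  obtain ⟨c0, hc0⟩ := hcentre
  set cN : ℚ := (n ! : ℚ) ^ (A - 2 * B) * c0 * (∏ m ∈ Icc 1 n, (-((K : ℚ) + m))) ^ B *
    (∏ m ∈ Icc 1 n, ((n : ℚ) + m - K)) ^ B with hcN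
  set cD : ℚ := (∏ m ∈ (range (n + 1)).erase K, ((m : ℚ) - K)) ^ A with hcD
  have hN : ((taylor (-(K : ℚ)) (kerNum A B ε n) : ℚ[X]) : PowerSeries ℚ) = PowerSeries.C cN * UN := by
    rw [taylor_kerNum, Polynomial.coe_mul, Polynomial.coe_mul, Polynomial.coe_mul, Polynomial.coe_pow,
      Polynomial.coe_pow, Polynomial.coe_pow, Polynomial.coe_C, coe_prod_X_add_C _ h1, coe_prod_X_add_C _ h2, hc0,
      hcN, hUN]
    simp only [map_mul, map_pow, mul_pow]
    ring
  have hD : ((taylor (-(K : ℚ)) (kerDenErase A n K) : ℚ[X]) : PowerSeries ℚ) =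
      PowerSeries.C cD * ∏ m ∈ (range (n + 1)).erase K, lin ((m : ℚ) - K) ^ A := by
    rw [taylor_kerDenErase, Polynomial.coe_pow, coe_prod_X_add_C _ h3, mul_pow, ← map_pow, Finset.prod_pow]
  -- `U(0) = 1`
  have hU1 : PowerSeries.constantCoeff (UN * G) = 1 := by
    rw [hUN, hG]
    simp only [map_mul, map_pow, map_prod, constantCoeff_lin, constantCoeff_geom, one_pow, Finset.prod_const_one,
      mul_one]
  -- the budget of `U`
  have hA : IsScaledInt p w (ε * (padicValNat p ((n : ℤ) - 2 * K).natAbs - w)) (lin xc ^ ε) := by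
    rcases hc with hc | hc
    · have hz : ((n : ℤ) - 2 * K) ≠ 0 := fun h => hc (by omega)
      refine isScaledInt_pow (isScaledInt_lin ?_) ε
      have h2v : Rat.padicValuation p (2 : ℚ) ≤ 1 := by
        have := Int.padicValuation_le_one p 2
        rwa [← Rat.padicValuation_cast, Int.cast_ofNat] at this
      rw [hxc', inv_div, div_eq_mul_inv, map_mul, padicValuation_inv_intCast hz]
      calc Rat.padicValuation p 2 * exp ((padicValNat p ((n : ℤ) - 2 * K).natAbs : ℕ) : ℤ)
          ≤ 1 * exp ((padicValNat p ((n : ℤ) - 2 * K).natAbs : ℕ) : ℤ) := mul_le_mul' h2v le_rfl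
        _ ≤ _ := by rw [one_mul, exp_le_exp]; exact Nat.cast_le.2 (by omega)
    · subst hc; simpa using isScaledInt_one (p := p) w
  have hB1 : IsScaledInt p w (∑ m ∈ Icc 1 n, (padicValNat p (K + m) - w)) (∏ m ∈ Icc 1 n, lin (-((K : ℚ) + m))) :=
    isScaledInt_prod _ fun m hm => isScaledInt_lin (by
      have := (mem_Icc.1 hm).1
      rw [inv_neg, Valuation.map_neg, ← Nat.cast_add]
      exact padicValuation_inv_natCast_le (by omega) w)
  have hB2 : IsScaledInt p w (∑ m ∈ Icc 1 n, (padicValNat p (n + m - K) - w)) (∏ m ∈ Icc 1 n, lin ((n : ℚ) + m - K)) :=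
    isScaledInt_prod _ fun m hm => isScaledInt_lin (by
      have := (mem_Icc.1 hm).1
      rw [← Nat.cast_add, ← Nat.cast_sub (by omega)]
      exact padicValuation_inv_natCast_le (by omega) w)
  have hGint : IsScaledInt p w 0 G := by
    have h := isScaledInt_prod (p := p) (w := w) (e := fun _ => 0) (f := fun m : ℕ => geom ((m : ℚ) - K)⁻¹ ^ A)
      ((range (n + 1)).erase K) fun m hm => ?_
    · simpa only [Finset.sum_const_zero] using h
    · have hz : ((m : ℤ) - K) ≠ 0 := fun h => Finset.ne_of_mem_erase hm (by omega)
      have hmn : m ≤ n := by have := mem_range.1 (mem_erase.1 hm).2; omega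
      have hy : Rat.padicValuation p (((m : ℚ) - K))⁻¹ ≤ exp ((w : ℕ) : ℤ) := by
        rw [show ((m : ℚ) - K) = (((m : ℤ) - K : ℤ) : ℚ) by push_cast; ring, padicValuation_inv_intCast hz,
          exp_le_exp]
        exact Nat.cast_le.2 (hden _ (Int.natAbs_pos.2 hz) (by omega))
      have := isScaledInt_pow (isScaledInt_geom hy) A
      rwa [mul_zero] at this
  have hint : IsScaledInt p w e (UN * G) := by
    have h := isScaledInt_mul (isScaledInt_mul hA (isScaledInt_mul (isScaledInt_pow hB1 B) (isScaledInt_pow hB2 B))) hGint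
    refine isScaledInt_mono ?_ h
    rw [Finset.sum_add_distrib, mul_add] at he
    omega
  -- the identity `F_K = C(cN/cD)·(UN·G)` and `F_K(0) = cN/cD`
  have hF : laurentSeries A B ε n K = PowerSeries.C (cN * cD⁻¹) * (UN * G) := by
    rw [laurentSeries, expandAt, hN, hD, PowerSeries.mul_inv_rev, PowerSeries.C_inv,
      prod_lin_pow_inv _ (fun m : ℕ => (m : ℚ) - K) A, ← hG,
      show PowerSeries.C (cN * cD⁻¹) = PowerSeries.C cN * PowerSeries.C cD⁻¹ from map_mul _ _ _]
    ring
  have h0 : laurent A B ε n K 0 = cN * cD⁻¹ := by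
    rw [laurent, hF, PowerSeries.coeff_zero_eq_constantCoeff_apply, map_mul, PowerSeries.constantCoeff_C, hU1, mul_one]
  exact ⟨UN * G, hU1, hint, by rw [h0, hF]⟩

/-- **MASTER VALUATION BOUND** (THEOREM 5 Step C / THEOREM 6 C⁺ / PLAN-T7 L7.1 / G⁺ by choice of `w, e`): under the
hypotheses of `laurentSeries_eq_C_mul` and `2B ≤ A`, for every depth `d`:
`v(laurent A B ε n K d) ≤ v(cTop A B ε n K)·exp(w·d + e)`, i.e. `v_p(c_{K,A−d}(n)) ≥ v_p(c_{K,A}(n)) − w·d − e`. -/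
theorem padicValuation_laurent_le {A B : ℕ} (hAB : 2 * B ≤ A) {ε n K : ℕ} (hK : K ≤ n) (hc : 2 * K ≠ n ∨ ε = 0)
    {w e : ℕ} (hden : ∀ d, 0 < d → d ≤ n → padicValNat p d ≤ w)
    (he : ε * (padicValNat p ((n : ℤ) - 2 * K).natAbs - w) +
        B * ∑ m ∈ Icc 1 n, ((padicValNat p (K + m) - w) + (padicValNat p (n + m - K) - w)) ≤ e) (d : ℕ) :
    Rat.padicValuation p (laurent A B ε n K d) ≤
      Rat.padicValuation p (cTop A B ε n K) * exp (((w * d + e : ℕ) : ℤ)) := by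
  obtain ⟨U, -, hU, hF⟩ := laurentSeries_eq_C_mul (p := p) A B hK hc hden he
  rw [laurent, hF, PowerSeries.coeff_C_mul, map_mul, laurent_zero hAB ε hK]
  exact mul_le_mul' le_rfl (hU d)

/-- The same in zi-p2's indexing: `v_p(c_{K,s}(n)) ≥ v_p(c_{K,A}(n)) − w·(A−s) − e`. -/
theorem padicValuation_cell_le {A B : ℕ} (hAB : 2 * B ≤ A) {ε n K : ℕ} (hK : K ≤ n) (hc : 2 * K ≠ n ∨ ε = 0)
    {w e : ℕ} (hden : ∀ d, 0 < d → d ≤ n → padicValNat p d ≤ w)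
    (he : ε * (padicValNat p ((n : ℤ) - 2 * K).natAbs - w) +
        B * ∑ m ∈ Icc 1 n, ((padicValNat p (K + m) - w) + (padicValNat p (n + m - K) - w)) ≤ e) (s : ℕ) :
    Rat.padicValuation p (cell A B ε n K s) ≤
      Rat.padicValuation p (cTop A B ε n K) * exp (((w * (A - s) + e : ℕ) : ℤ)) :=
  padicValuation_laurent_le hAB hK hc hden he (A - s)

end

end Summit.KontsevichZagierPeriods.Zeta5Search.BrickLaurentValuation
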